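import Mathlib
import Summits.MatrixMultiplication.MatrixMultiplication.Theorems.GradedDesignFamily.Negative.SubfieldCellNormalForm
import Summits.MatrixMultiplication.MatrixMultiplication.Theorems.GradedDesignFamily.Negative.SubfieldCellDensePiece
import Summits.MatrixMultiplication.MatrixMultiplication.Theorems.GradedDesignFamily.Negative.SubfieldCellSlicedEndgame
import Summits.MatrixMultiplication.MatrixMultiplication.Theorems.GradedDesignFamily.Negative.SubfieldCellStructureTripleAux

/-!
# Subfield cell — (S″): the sliced structure conclusion from (F0) ∧ (P1) ∧ (KL-P) ∧ (P4), NO BGT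

Unit `b2b-lgcu-subfield` (gen 20), supporting `stmt-MatrixMultiplication-7610` (crux
`LevelGradedCohnUmans.GradedDesignFamily`, negative side; SUBFIELD.md §25).

`structureSliced_of_tripleProduct` has the SAME conclusion as `structureSliced_of_pieces`
(`SubfieldCellStructureSliced.lean`) but replaces its hypothesis (BGT) — the Breuillard–Green–Tao
product theorem, a named unproved fact — by two ELEMENTARY counting statements about the subfield
copy `S₀ = SL₂(ι k) ≤ SL₂(K)`, `|K| = |k|²`:
* (F0)   `|N(S₀)| ≤ 2·|SL₂(k)|` (proved in the tree: `subfieldCell_normalizer_card_le`);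
* (KL-P) the triple-product bound `|P|(|P| − C₁q²)|P| ≤ C₂ q³ · |ι(P) b ι(P) b' ι(P)|` for
  `P ⊆ SL₂(k)` and `b, b' ∈ SL₂(K) ∖ N(S₀)`.
Argument: by `densePiece_of_subset_mul` a piece `P ⊆ SL₂(k)` with `|SL₂ k| ≤ M|P|` has
`x⁻¹ φ(P P⁻¹) x ⊆ A² ∩ SL₂`; by the normal form `φ = g₀ ι g₀⁻¹`; by (P1) and (F0) some
`b ∈ A² ∩ SL₂` has `β = g₀⁻¹ x b x⁻¹ g₀ ∉ N(S₀)`; then `x⁻¹ g₀ (ι(P₁) β ι(P₁) β ι(P₁)) g₀⁻¹ x ⊆ A¹⁰`,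
so (KL-P) makes `A¹⁶ ∩ SL₂` dense and (P4) for the approximate group `A⁴` bounds `det(A)`.
No generation dichotomy, no (NG), no Dickson, no BGT.

HONEST FRAMING: a step toward an UNCONDITIONAL `¬ stub_subfieldCell`; NOT summit progress.
Sorry-free. [folklore]
-/

set_option linter.dupNamespace false

open scoped Pointwise

namespace Summit.MatrixMultiplication.MatrixMultiplication.Theorems.GradedDesignFamily.Negative

/-- **(S″) from (F0) ∧ (P1) ∧ (KL-P) ∧ (P4).**  NOT summit progress. [folklore] -/
theorem structureSliced_of_tripleProduct
    (hN : ∀ (k K : Type) [Field k] [Fintype k] [DecidableEq k] [Field K] [Fintype K] [DecidableEq K]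
      (ι : k →+* K), Fintype.card K = Fintype.card k ^ 2 →
      Nat.card (Subgroup.normalizer (((Matrix.SpecialLinearGroup.map ι :
          Matrix.SpecialLinearGroup (Fin 2) k →* Matrix.SpecialLinearGroup (Fin 2) K).range :
          Subgroup (Matrix.SpecialLinearGroup (Fin 2) K)) :
          Set (Matrix.SpecialLinearGroup (Fin 2) K))) ≤
        2 * Fintype.card (Matrix.SpecialLinearGroup (Fin 2) k))
    (hP1 : ∀ (K : Type) [Field K] [Fintype K] [DecidableEq K]
      (A : Finset (Matrix.GeneralLinearGroup (Fin 2) K)), A.Nonempty →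
      (↑A : Set (Matrix.GeneralLinearGroup (Fin 2) K))⁻¹ = ↑A →
      A.card ≤ (Fintype.card K - 1) *
        ((A ^ 2).filter fun g => Matrix.GeneralLinearGroup.det g = 1).card)
    (hTP : ∃ C₁ C₂ : ℝ, 0 < C₂ ∧ ∃ q₀ : ℕ,
      ∀ (k K : Type) [Field k] [Fintype k] [DecidableEq k] [Field K] [Fintype K] [DecidableEq K]
        (ι : k →+* K), Fintype.card K = Fintype.card k ^ 2 → q₀ ≤ Fintype.card k →
        ∀ (P : Finset (Matrix.SpecialLinearGroup (Fin 2) k))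
          (b b' : Matrix.SpecialLinearGroup (Fin 2) K),
          b ∉ Subgroup.normalizer (((Matrix.SpecialLinearGroup.map ι :
              Matrix.SpecialLinearGroup (Fin 2) k →* Matrix.SpecialLinearGroup (Fin 2) K).range :
              Subgroup (Matrix.SpecialLinearGroup (Fin 2) K)) :
              Set (Matrix.SpecialLinearGroup (Fin 2) K)) →
          b' ∉ Subgroup.normalizer (((Matrix.SpecialLinearGroup.map ι :
              Matrix.SpecialLinearGroup (Fin 2) k →* Matrix.SpecialLinearGroup (Fin 2) K).range :
              Subgroup (Matrix.SpecialLinearGroup (Fin 2) K)) :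
              Set (Matrix.SpecialLinearGroup (Fin 2) K)) →
          (P.card : ℝ) * ((P.card : ℝ) - C₁ * (Fintype.card k : ℝ) ^ 2) * P.card ≤
            C₂ * (Fintype.card k : ℝ) ^ 3 *
              ((P.image (Matrix.SpecialLinearGroup.map ι) * {b} *
                P.image (Matrix.SpecialLinearGroup.map ι) * {b'} *
                P.image (Matrix.SpecialLinearGroup.map ι)).card : ℝ))
    (hP4 : ∀ M c₂ C : ℝ, 1 ≤ M → 0 < c₂ → 0 < C → ∃ m₀ Q₆ : ℕ,
      ∀ (K : Type) [Field K] [Fintype K] [DecidableEq K], Q₆ ≤ Fintype.card K →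
        ∀ A : Finset (Matrix.GeneralLinearGroup (Fin 2) K),
          IsApproximateSubgroup M (A : Set (Matrix.GeneralLinearGroup (Fin 2) K)) →
          (A.card : ℝ) ≤ c₂ * (Fintype.card K : ℝ) ^ 3 →
          (Nat.card (Matrix.GeneralLinearGroup.det :
              Matrix.GeneralLinearGroup (Fin 2) K →* Kˣ).ker : ℝ) ≤
            C * ((A ^ 4).filter fun g => Matrix.GeneralLinearGroup.det g = 1).card →
          (A.image Matrix.GeneralLinearGroup.det).card ≤ m₀) :
    ∀ M c₁ c₂ : ℝ, 1 ≤ M → 0 < c₁ → 0 < c₂ → ∃ m₀ Q₂ : ℕ,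
      ∀ (k K : Type) [Field k] [Fintype k] [DecidableEq k] [Field K] [Fintype K] [DecidableEq K]
        (φ : Matrix.SpecialLinearGroup (Fin 2) k →* Matrix.GeneralLinearGroup (Fin 2) K),
        Function.Injective φ → Fintype.card K = Fintype.card k ^ 2 → Q₂ ≤ Fintype.card K →
        ∀ A X Y : Finset (Matrix.GeneralLinearGroup (Fin 2) K),
          IsApproximateSubgroup M (A : Set (Matrix.GeneralLinearGroup (Fin 2) K)) →
          c₁ * (Fintype.card K : ℝ) ^ 3 ≤ A.card → (A.card : ℝ) ≤ c₂ * (Fintype.card K : ℝ) ^ 3 →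
          (X.card : ℝ) ≤ M → Y.Nonempty → Finset.univ.image φ * Y ⊆ X * A →
          (A.image Matrix.GeneralLinearGroup.det).card ≤ m₀ := by
  intro M c₁ c₂ hM hc₁ hc₂
  obtain ⟨C₁, C₂, hC₂, q₀, hT⟩ := hTP
  have hM0 : 0 < M := by linarith
  have hM15 : (1 : ℝ) ≤ (M ^ 5) ^ 3 := one_le_pow₀ (one_le_pow₀ hM)
  have hc₂' : 0 < M ^ 3 * c₂ := by positivity
  have hC : 0 < 16 * M ^ 3 * C₂ := by positivity
  obtain ⟨m₀, Q₆, h4⟩ := hP4 ((M ^ 5) ^ 3) (M ^ 3 * c₂) (16 * M ^ 3 * C₂) hM15 hc₂' hC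
  refine ⟨m₀, max (max Q₆ (q₀ ^ 2)) (max ((⌊2 / c₁⌋₊ + 1) ^ 2) ((⌈2 * M * |C₁|⌉₊ + 2) ^ 2)), ?_⟩
  intro k K _ _ _ _ _ _ φ hφ hK hQ A X Y happ hlo hhi hX hYne hcov
  classical
  -- ### sizes
  set q := Fintype.card k with hqdef
  have hQ6 : Q₆ ≤ Fintype.card K := ((le_max_left _ _).trans (le_max_left _ _)).trans hQ
  have hq₀ : q₀ ≤ q := by
    have h : q₀ ^ 2 ≤ q ^ 2 := by
      rw [← hK]; exact ((le_max_right _ _).trans (le_max_left _ _)).trans hQ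
    exact (Nat.pow_le_pow_iff_left two_ne_zero).1 h
  have hqc : 2 < c₁ * q := by
    have h1 : (⌊2 / c₁⌋₊ + 1) ^ 2 ≤ q ^ 2 := by
      rw [← hK]; exact ((le_max_left _ _).trans (le_max_right _ _)).trans hQ
    have h2 : ⌊2 / c₁⌋₊ + 1 ≤ q := (Nat.pow_le_pow_iff_left two_ne_zero).1 h1
    have h3 : 2 / c₁ < q := (Nat.lt_floor_add_one _).trans_le (by exact_mod_cast h2)
    rw [div_lt_iff₀ hc₁] at h3
    linarith
  have hqC : 2 * M * |C₁| + 1 ≤ (q : ℝ) ∧ (2 : ℝ) ≤ q := by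
    have h1 : (⌈2 * M * |C₁|⌉₊ + 2) ^ 2 ≤ q ^ 2 := by
      rw [← hK]; exact ((le_max_right _ _).trans (le_max_right _ _)).trans hQ
    have h2 : ⌈2 * M * |C₁|⌉₊ + 2 ≤ q := (Nat.pow_le_pow_iff_left two_ne_zero).1 h1
    have h3 : (⌈2 * M * |C₁|⌉₊ : ℝ) + 2 ≤ q := by exact_mod_cast h2
    have h4 := Nat.le_ceil (2 * M * |C₁|)
    have h5 : (0 : ℝ) ≤ ⌈2 * M * |C₁|⌉₊ := Nat.cast_nonneg _
    exact ⟨by linarith, by linarith⟩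
  obtain ⟨hqC1, hq2⟩ := hqC
  have hqpos : (0 : ℝ) < q := by linarith
  have hQq : (Fintype.card K : ℝ) = (q : ℝ) ^ 2 := by rw [hK]; norm_num
  -- `|SL₂(k)| ≤ q³`, `q²(q-1) ≤ |SL₂(k)|`, `|ker det (K)| ≤ |K|³ = q⁶`
  have hSLk_le : (Fintype.card (Matrix.SpecialLinearGroup (Fin 2) k) : ℝ) ≤ (q : ℝ) ^ 3 := by
    exact_mod_cast card_specialLinearGroup_fin_two_le k
  have hSLk_ge : (q : ℝ) * ((q : ℝ) * ((q : ℝ) - 1)) ≤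
      (Fintype.card (Matrix.SpecialLinearGroup (Fin 2) k) : ℝ) :=
    card_specialLinearGroup_fin_two_ge_real k
  have hkerK : (Nat.card (Matrix.GeneralLinearGroup.det :
      Matrix.GeneralLinearGroup (Fin 2) K →* Kˣ).ker : ℝ) ≤ (q : ℝ) ^ 6 := by
    calc (Nat.card (Matrix.GeneralLinearGroup.det :
          Matrix.GeneralLinearGroup (Fin 2) K →* Kˣ).ker : ℝ)
        ≤ Fintype.card (Matrix.SpecialLinearGroup (Fin 2) K) := by
          exact_mod_cast natCard_ker_det_le_card K
      _ ≤ (Fintype.card K : ℝ) ^ 3 := by exact_mod_cast card_specialLinearGroup_fin_two_le K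
      _ = (q : ℝ) ^ 6 := by rw [hQq]; ring
  -- ### `A`: symmetric, contains `1`; `B₂ = A² ∩ SL₂` is large (P1)
  have hsymm : (↑A : Set (Matrix.GeneralLinearGroup (Fin 2) K))⁻¹ = ↑A := happ.inv_eq_self
  have h1 : (1 : Matrix.GeneralLinearGroup (Fin 2) K) ∈ A := Finset.mem_coe.1 happ.one_mem
  have hne : A.Nonempty := ⟨1, h1⟩
  have hAinv : A⁻¹ = A := by rw [← Finset.coe_inj, Finset.coe_inv, hsymm]
  have hQpos : (0 : ℝ) < (Fintype.card K : ℝ) := by rw [hQq]; positivity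
  set B₂ : Finset (Matrix.GeneralLinearGroup (Fin 2) K) :=
    (A ^ 2).filter fun g => Matrix.GeneralLinearGroup.det g = 1 with hB₂
  have hA2 : c₁ * (q : ℝ) ^ 4 ≤ (B₂.card : ℝ) := by
    have hP := hP1 K A hne hsymm
    have hP' : A.card ≤ Fintype.card K * B₂.card :=
      hP.trans (Nat.mul_le_mul_right _ (Nat.sub_le _ _))
    have hP'' : (A.card : ℝ) ≤ (Fintype.card K : ℝ) * B₂.card := by exact_mod_cast hP'
    have hlo' : c₁ * (Fintype.card K : ℝ) ^ 3 ≤ (Fintype.card K : ℝ) * B₂.card := hlo.trans hP''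
    rw [hQq] at hlo'
    have e : c₁ * ((q : ℝ) ^ 2) ^ 3 = (q : ℝ) ^ 2 * (c₁ * (q : ℝ) ^ 4) := by ring
    rw [e] at hlo'
    exact le_of_mul_le_mul_left hlo' (by positivity)
  -- ### the dense piece `P` of `φ(SL₂ k)` and its translate `P₁ = P s₀⁻¹`
  have hSne : (Finset.univ.image φ).Nonempty :=
    ⟨1, Finset.mem_image.2 ⟨1, Finset.mem_univ _, map_one φ⟩⟩
  obtain ⟨x, -, y, -, hcard, hpairs⟩ :=
    densePiece_of_subset_mul (Finset.univ.image φ) Y X A hSne hYne hcov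
  set P : Finset (Matrix.SpecialLinearGroup (Fin 2) k) :=
    Finset.univ.filter (fun a : Matrix.SpecialLinearGroup (Fin 2) k => x⁻¹ * φ a * y ∈ A)
    with hPdef
  have hfilt : (Finset.univ.image φ).filter
      (fun s : Matrix.GeneralLinearGroup (Fin 2) K => x⁻¹ * s * y ∈ A) = P.image φ := by
    ext s
    simp only [Finset.mem_filter, Finset.mem_image, Finset.mem_univ, true_and, hPdef]
    constructor
    · rintro ⟨⟨a, rfl⟩, h⟩
      exact ⟨a, h, rfl⟩
    · rintro ⟨a, h, rfl⟩
      exact ⟨⟨a, rfl⟩, h⟩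
  have hPcard : (Fintype.card (Matrix.SpecialLinearGroup (Fin 2) k) : ℝ) ≤ M * P.card := by
    have h1' : Fintype.card (Matrix.SpecialLinearGroup (Fin 2) k) = (Finset.univ.image φ).card := by
      rw [Finset.card_image_of_injective _ hφ, Finset.card_univ]
    have h2 : (Finset.univ.image φ).card ≤ X.card * P.card := by
      rw [hfilt, Finset.card_image_of_injective P hφ] at hcard
      exact hcard
    have h3' : (Fintype.card (Matrix.SpecialLinearGroup (Fin 2) k) : ℝ) ≤ (X.card : ℝ) * P.card := by
      rw [h1']
      exact_mod_cast h2
    exact h3'.trans (mul_le_mul_of_nonneg_right hX (Nat.cast_nonneg _))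
  have hPpos : 0 < P.card := by
    have h0 : (0 : ℝ) < Fintype.card (Matrix.SpecialLinearGroup (Fin 2) k) := by
      exact_mod_cast Fintype.card_pos_iff.2 ⟨1⟩
    have h0' : (0 : ℝ) < M * P.card := h0.trans_le hPcard
    have h0'' : (0 : ℝ) < P.card := pos_of_mul_pos_right h0' hM0.le
    exact_mod_cast h0''
  obtain ⟨s₀, hs₀⟩ := Finset.card_pos.1 hPpos
  -- members of `P P⁻¹` conjugate into `B₂`
  have hPB : ∀ s ∈ P, ∀ s' ∈ P, x⁻¹ * φ (s * s'⁻¹) * x ∈ B₂ := by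
    intro s hs s' hs'
    have hsF : φ s ∈ (Finset.univ.image φ).filter
        (fun s : Matrix.GeneralLinearGroup (Fin 2) K => x⁻¹ * s * y ∈ A) := by
      rw [hfilt]; exact Finset.mem_image_of_mem φ hs
    have hs'F : φ s' ∈ (Finset.univ.image φ).filter
        (fun s : Matrix.GeneralLinearGroup (Fin 2) K => x⁻¹ * s * y ∈ A) := by
      rw [hfilt]; exact Finset.mem_image_of_mem φ hs'
    have hmem : x⁻¹ * (φ s * (φ s')⁻¹) * x ∈ A * A⁻¹ := hpairs _ hsF _ hs'F
    rw [hAinv, ← sq] at hmem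
    have hdet : Matrix.GeneralLinearGroup.det (x⁻¹ * (φ s * (φ s')⁻¹) * x) = 1 := by
      rw [map_mul, map_mul, map_inv, inv_mul_cancel_comm, ← map_inv, ← map_mul]
      exact Units.ext (by
        rw [Matrix.GeneralLinearGroup.val_det_apply, Units.val_one]
        exact subfieldCell_det_eq_one φ hK _)
    have e : x⁻¹ * φ (s * s'⁻¹) * x = x⁻¹ * (φ s * (φ s')⁻¹) * x := by rw [map_mul, map_inv]
    rw [e]
    exact Finset.mem_filter.2 ⟨hmem, hdet⟩
  set P₁ : Finset (Matrix.SpecialLinearGroup (Fin 2) k) := P.image (· * s₀⁻¹) with hP₁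
  have hP₁card : P₁.card = P.card := Finset.card_image_of_injective _ (mul_left_injective _)
  have hP₁B : ∀ p ∈ P₁, x⁻¹ * φ p * x ∈ B₂ := by
    intro p hp
    obtain ⟨s, hs, rfl⟩ := Finset.mem_image.1 hp
    exact hPB s hs s₀ hs₀
  -- ### normal form `φ = g₀ ι g₀⁻¹`, the subfield copy `S₀` and its normaliser `N`
  obtain ⟨ι, g₀, hnf⟩ := subfieldCell_normalForm φ hφ hK
  set N : Subgroup (Matrix.SpecialLinearGroup (Fin 2) K) :=
    Subgroup.normalizer (((Matrix.SpecialLinearGroup.map ι :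
      Matrix.SpecialLinearGroup (Fin 2) k →* Matrix.SpecialLinearGroup (Fin 2) K).range :
      Subgroup (Matrix.SpecialLinearGroup (Fin 2) K)) :
      Set (Matrix.SpecialLinearGroup (Fin 2) K)) with hNdef
  have hNcard : (Nat.card N : ℝ) ≤ 2 * (q : ℝ) ^ 3 := by
    have h := hN k K ι hK
    have h' : (Nat.card N : ℝ) ≤ 2 * (Fintype.card (Matrix.SpecialLinearGroup (Fin 2) k) : ℝ) := by
      exact_mod_cast h
    linarith
  -- `GL₂ → SL₂` on determinant-one elements
  let toSL : Matrix.GeneralLinearGroup (Fin 2) K → Matrix.SpecialLinearGroup (Fin 2) K := fun g =>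
    if h : ((g : Matrix.GeneralLinearGroup (Fin 2) K) : Matrix (Fin 2) (Fin 2) K).det = 1 then
      ⟨(g : Matrix (Fin 2) (Fin 2) K), h⟩ else 1
  have htoSL : ∀ g : Matrix.GeneralLinearGroup (Fin 2) K, Matrix.GeneralLinearGroup.det g = 1 →
      ((toSL g : Matrix.SpecialLinearGroup (Fin 2) K) : Matrix (Fin 2) (Fin 2) K) =
        (g : Matrix (Fin 2) (Fin 2) K) := by
    intro g hg
    have hg' : ((g : Matrix.GeneralLinearGroup (Fin 2) K) : Matrix (Fin 2) (Fin 2) K).det = 1 := by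
      rw [← Matrix.GeneralLinearGroup.val_det_apply, hg, Units.val_one]
    simp only [toSL, dif_pos hg']
  have htoGL : ∀ g : Matrix.GeneralLinearGroup (Fin 2) K, Matrix.GeneralLinearGroup.det g = 1 →
      Matrix.SpecialLinearGroup.toGL (toSL g) = g := by
    intro g hg
    exact Units.ext (by rw [Matrix.SpecialLinearGroup.coe_GL_coe_matrix, htoSL g hg])
  -- conjugation `b ↦ g₀⁻¹ x b x⁻¹ g₀`
  set cj : Matrix.GeneralLinearGroup (Fin 2) K → Matrix.GeneralLinearGroup (Fin 2) K :=
    fun b => g₀⁻¹ * x * b * x⁻¹ * g₀ with hcj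
  have hcj_det : ∀ b, Matrix.GeneralLinearGroup.det (cj b) = Matrix.GeneralLinearGroup.det b := by
    intro b
    simp only [hcj, map_mul, map_inv]
    calc (Matrix.GeneralLinearGroup.det g₀)⁻¹ * Matrix.GeneralLinearGroup.det x *
          Matrix.GeneralLinearGroup.det b * (Matrix.GeneralLinearGroup.det x)⁻¹ *
          Matrix.GeneralLinearGroup.det g₀
        = Matrix.GeneralLinearGroup.det b *
            ((Matrix.GeneralLinearGroup.det g₀)⁻¹ * Matrix.GeneralLinearGroup.det g₀) *
            (Matrix.GeneralLinearGroup.det x * (Matrix.GeneralLinearGroup.det x)⁻¹) := by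
          simp only [mul_assoc, mul_comm, mul_left_comm]
      _ = Matrix.GeneralLinearGroup.det b := by simp
  have hcj_inj : Function.Injective cj := by
    intro b b' e
    simp only [hcj] at e
    have := congr_arg (fun g => x⁻¹ * g₀ * g * g₀⁻¹ * x) e
    simpa [mul_assoc] using this
  -- ### some `b ∈ B₂` conjugates outside `N`
  have hbad : ((B₂.filter fun b => toSL (cj b) ∈ N).card : ℝ) ≤ 2 * (q : ℝ) ^ 3 := by
    have hle : (B₂.filter fun b => toSL (cj b) ∈ N).card ≤ Nat.card N := by
      rw [← Fintype.card_coe, ← Nat.card_eq_fintype_card]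
      refine Nat.card_le_card_of_injective (fun b => (⟨toSL (cj b.1), (Finset.mem_filter.1 b.2).2⟩ : N)) ?_
      intro b b' e
      have e1 : toSL (cj b.1) = toSL (cj b'.1) := congr_arg Subtype.val e
      have hb : Matrix.GeneralLinearGroup.det (cj b.1) = 1 := by
        rw [hcj_det]; exact (Finset.mem_filter.1 (Finset.mem_filter.1 b.2).1).2
      have hb' : Matrix.GeneralLinearGroup.det (cj b'.1) = 1 := by
        rw [hcj_det]; exact (Finset.mem_filter.1 (Finset.mem_filter.1 b'.2).1).2
      have e2 : cj b.1 = cj b'.1 := by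
        rw [← htoGL _ hb, ← htoGL _ hb', e1]
      exact Subtype.ext (hcj_inj e2)
    calc ((B₂.filter fun b => toSL (cj b) ∈ N).card : ℝ) ≤ Nat.card N := by exact_mod_cast hle
      _ ≤ 2 * (q : ℝ) ^ 3 := hNcard
  obtain ⟨b, hbB, hbN⟩ : ∃ b ∈ B₂, toSL (cj b) ∉ N := by
    by_contra hall
    push Not at hall
    have hsub : B₂ ⊆ B₂.filter fun b => toSL (cj b) ∈ N := fun b hb =>
      Finset.mem_filter.2 ⟨hb, hall b hb⟩
    have h1' : (B₂.card : ℝ) ≤ (B₂.filter fun b => toSL (cj b) ∈ N).card := by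
      exact_mod_cast Finset.card_le_card hsub
    have h2 : c₁ * (q : ℝ) ^ 4 ≤ 2 * (q : ℝ) ^ 3 := hA2.trans (h1'.trans hbad)
    have h3 : (q : ℝ) ^ 3 * 2 < (q : ℝ) ^ 3 * (c₁ * q) := mul_lt_mul_of_pos_left hqc (by positivity)
    have e : (q : ℝ) ^ 3 * (c₁ * q) = c₁ * (q : ℝ) ^ 4 := by ring
    linarith
  have hbdet : Matrix.GeneralLinearGroup.det b = 1 := (Finset.mem_filter.1 hbB).2
  have hbA2 : b ∈ A ^ 2 := (Finset.mem_filter.1 hbB).1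
  set β : Matrix.SpecialLinearGroup (Fin 2) K := toSL (cj b) with hβ
  have hβGL : Matrix.SpecialLinearGroup.toGL β = g₀⁻¹ * x * b * x⁻¹ * g₀ :=
    htoGL _ (by rw [hcj_det]; exact hbdet)
  -- ### the conjugation hom `ψ = (x⁻¹ g₀) · toGL · (x⁻¹ g₀)⁻¹`
  set ψ : Matrix.SpecialLinearGroup (Fin 2) K →* Matrix.GeneralLinearGroup (Fin 2) K :=
    (MulAut.conj (x⁻¹ * g₀)).toMonoidHom.comp Matrix.SpecialLinearGroup.toGL with hψdef
  have hψ : ∀ t, ψ t = x⁻¹ * g₀ * Matrix.SpecialLinearGroup.toGL t * g₀⁻¹ * x := by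
    intro t
    simp only [hψdef, MonoidHom.comp_apply, MulEquiv.coe_toMonoidHom, MulAut.conj_apply,
      mul_inv_rev, inv_inv, mul_assoc]
  have hψinj : Function.Injective ψ := fun a b h =>
    Matrix.SpecialLinearGroup.toGL_injective ((MulAut.conj (x⁻¹ * g₀)).injective h)
  have hψdet : ∀ t, Matrix.GeneralLinearGroup.det (ψ t) = 1 := by
    intro t
    rw [hψ]
    simp only [map_mul, map_inv, Matrix.SpecialLinearGroup.coeToGL_det, mul_one,
      mul_inv_cancel_right, inv_mul_cancel]
  have hψι : ∀ p : Matrix.SpecialLinearGroup (Fin 2) k,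
      ψ (Matrix.SpecialLinearGroup.map ι p) = x⁻¹ * φ p * x := by
    intro p
    rw [hψ, hnf p]
    group
  have hψβ : ψ β = b := by
    rw [hψ, hβGL]
    group
  -- ### the triple product `T` embeds into `A¹⁶ ∩ SL₂`
  set Pι : Finset (Matrix.SpecialLinearGroup (Fin 2) K) := P₁.image (Matrix.SpecialLinearGroup.map ι)
    with hPι
  set T : Finset (Matrix.SpecialLinearGroup (Fin 2) K) := Pι * {β} * Pι * {β} * Pι with hTdef
  obtain ⟨hsub, hA10⟩ := subset_sq_sq h1
  have hTsub : T.image ψ ⊆ (((A ^ 2) ^ 2) ^ 4).filter fun g => Matrix.GeneralLinearGroup.det g = 1 := by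
    intro g hg
    obtain ⟨t, ht, rfl⟩ := Finset.mem_image.1 hg
    refine Finset.mem_filter.2 ⟨hA10 ?_, hψdet t⟩
    simp only [hTdef, Finset.mem_mul, Finset.mem_singleton] at ht
    obtain ⟨t4, ⟨t3, ⟨t2, ⟨p₁, hp₁, b₁, rfl, rfl⟩, p₂, hp₂, rfl⟩, b₂, rfl, rfl⟩, p₃, hp₃, rfl⟩ := ht
    obtain ⟨a₁, ha₁, rfl⟩ := Finset.mem_image.1 hp₁
    obtain ⟨a₂, ha₂, rfl⟩ := Finset.mem_image.1 hp₂
    obtain ⟨a₃, ha₃, rfl⟩ := Finset.mem_image.1 hp₃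
    rw [map_mul, map_mul, map_mul, map_mul, hψι, hψι, hψι, hψβ]
    have m₁ := (Finset.mem_filter.1 (hP₁B a₁ ha₁)).1
    have m₂ := (Finset.mem_filter.1 (hP₁B a₂ ha₂)).1
    have m₃ := (Finset.mem_filter.1 (hP₁B a₃ ha₃)).1
    exact Finset.mul_mem_mul (Finset.mul_mem_mul (Finset.mul_mem_mul (Finset.mul_mem_mul m₁ hbA2) m₂)
      hbA2) m₃
  have hTcard : (T.card : ℝ) ≤
      ((((A ^ 2) ^ 2) ^ 4).filter fun g => Matrix.GeneralLinearGroup.det g = 1).card := by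
    have := Finset.card_le_card hTsub
    rw [Finset.card_image_of_injective _ hψinj] at this
    exact_mod_cast this
  -- ### (KL-P)
  have hKL := hT k K ι hK hq₀ P₁ β β hbN hbN
  rw [hP₁card] at hKL
  -- ### `A⁴ = (A²)²` is an `M¹⁵`-approximate group of size `≤ M³ c₂ |K|³`
  have happ4 : IsApproximateSubgroup ((M ^ 5) ^ 3)
      (↑((A ^ 2) ^ 2) : Set (Matrix.GeneralLinearGroup (Fin 2) K)) := isApproximateSubgroup_sq_sq happ
  have hhi4 : ((((A ^ 2) ^ 2)).card : ℝ) ≤ M ^ 3 * c₂ * (Fintype.card K : ℝ) ^ 3 := by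
    calc ((((A ^ 2) ^ 2)).card : ℝ) ≤ M ^ 3 * A.card := card_sq_sq_le happ
      _ ≤ M ^ 3 * (c₂ * (Fintype.card K : ℝ) ^ 3) := by gcongr
      _ = M ^ 3 * c₂ * (Fintype.card K : ℝ) ^ 3 := by ring
  -- ### density of `A¹⁶ ∩ SL₂` from (KL-P)
  have hdense : (Nat.card (Matrix.GeneralLinearGroup.det :
      Matrix.GeneralLinearGroup (Fin 2) K →* Kˣ).ker : ℝ) ≤
      16 * M ^ 3 * C₂ * ((((A ^ 2) ^ 2) ^ 4).filter fun g => Matrix.GeneralLinearGroup.det g = 1).card := by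
    have hfin : (q : ℝ) ^ 6 ≤ 16 * M ^ 3 * C₂ * (T.card : ℝ) :=
      tripleProduct_arith hM0 hq2 hqC1 (Nat.cast_nonneg _) (hSLk_ge.trans hPcard) hKL
    calc (Nat.card (Matrix.GeneralLinearGroup.det :
          Matrix.GeneralLinearGroup (Fin 2) K →* Kˣ).ker : ℝ) ≤ (q : ℝ) ^ 6 := hkerK
      _ ≤ 16 * M ^ 3 * C₂ * (T.card : ℝ) := hfin
      _ ≤ 16 * M ^ 3 * C₂ *
          ((((A ^ 2) ^ 2) ^ 4).filter fun g => Matrix.GeneralLinearGroup.det g = 1).card := by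
        gcongr
  -- ### (P4) for `A⁴`, and monotonicity of `det`-images
  have h := h4 K hQ6 ((A ^ 2) ^ 2) happ4 hhi4 hdense
  exact (Finset.card_le_card (Finset.image_subset_image hsub)).trans h

end Summit.MatrixMultiplication.MatrixMultiplication.Theorems.GradedDesignFamily.Negative
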